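import Summits.ValiantsHypothesis.ValiantsHypothesis.Theorems.BarrierLeverAnchoredDoorHitsLowerPairsStarFactors

/-!
# Route BarrierLever — support item `AnchoredDoorHitsLowerPairs` (stmt-ValiantsHypothesis-22510), line `anchored_peeling`:
# THE PRODUCT DOOR IS A MEMBER OF 𝔄₂, part 2 — the arrow `Stmt.conjStarLower → AnchoredDoorHitsLowerPairs`

Continuation of `…StarFactors` (star point `starPoint g dd`, evaluated witness `W2 g dd = ∏ starFactor`, families `T11/T21/T12`, iterated
products `prod_T11/prod_T21/prod_T12`). Here: modulo squares of variables (`StarDoor.SqEq`),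
`(∏_a (1+x_a)) (∏_d (1+y_d)) · W₂ ≡ Π(g,dd) = ∏_d (1 + y_d ∏_b (1 + g_{bd} x_b)) · ∏_a (1 + x_a ∏_e (1 + dd_{ae} y_e))`
(`zeta_W2_sqeq_piPoly`: root-factor splitting `…StarCalc.root_factor_split` + linearisation + telescoping `Finset.prod_one_add_ordered`), whence
for injective LOWER families the star-forest block is `Zuᵀ · (layout of W₂) · Zw` with the `0/1` zeta matrices of the two families (`starMatrix_eq`),
the layout has determinant `eval (starPoint) (symbolicDet 2)` (`det_layout_W2`), and a nonsingular star-forest block forces `symbolicDet 2 ≠ 0`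
(`symbolicDet_two_ne_zero_of_starDet`). CONSEQUENCE: `anchoredDoorHitsLowerPairs_of_conjStarLower : Stmt.conjStarLower → AnchoredDoorHitsLowerPairs`
(the item BY NAME, `s = 2`, `h₀ = 0`, via `stub_genericPoint`), and the same from `Stmt.conjStarTN`. These are CONDITIONAL arrows: `Stmt.conjStarLower`
/ `Stmt.conjStarTN` (…StarDoor, p725521) are conjectures with a clean census, not theorems. Nothing here bears on crux 14610 or `VP ≠ VNP`.
-/

set_option linter.dupNamespace false

namespace Summit.ValiantsHypothesis.ValiantsHypothesis.Theorems.BarrierLever.AnchoredPeeling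

open Finset MvPolynomial
open Summit.ValiantsHypothesis.ValiantsHypothesis.Theorems.BarrierLever.BrickCalculus (pexpo pexpo_def pexpo_le_iff pexpo_sub
  pexpo_apply_castAdd pexpo_apply_natAdd)

noncomputable section

namespace StarDoor

variable {h : ℕ}

/-! ## 4. The square-free chain `ζ_x ζ_y · W₂ ≡ Π(g, dd)` -/

/-- Splitting a vertex weight: `1 + (g+dd) x_a y_d ≡ (1 + g x_a y_d)(1 + dd x_a y_d)`. -/
theorem vtx_split (g dd : Fin h → Fin h → ℂ) (a d : Fin h) :
    SqEq (1 + C (g a d + dd a d) * xv a * yv d) ((1 + C (g a d) * xv a * yv d) * (1 + C (dd a d) * xv a * yv d)) := by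
  have hexp : (1 + C (g a d) * xv a * yv d) * (1 + C (dd a d) * xv a * yv d) =
      (1 + C (g a d + dd a d) * xv a * yv d) + X (Fin.castAdd h a) * X (Fin.castAdd h a) * (C (g a d) * C (dd a d) * yv d * yv d) := by
    rw [map_add]; simp only [xv, yv]; ring
  rw [hexp]
  have := (SqEq.refl (1 + C (g a d + dd a d) * xv a * yv d)).add (SqEq.sq_mul_zero (Fin.castAdd h a) (C (g a d) * C (dd a d) * yv d * yv d))
  rw [add_zero] at this
  exact this.symm

/-- The E-door root factor of `(a, d)` with tails at earlier vertices. -/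
def ex (g : Fin h → Fin h → ℂ) (a d : Fin h) : MvPolynomial (Fin (h + h)) ℂ :=
  1 + (C (g a d) * xv a * yv d) * ∏ b ∈ Finset.Iio a, (1 + C (g b d) * xv b)

/-- The Eᵀ-door root factor of `(a, d)`. -/
def ey (dd : Fin h → Fin h → ℂ) (a d : Fin h) : MvPolynomial (Fin (h + h)) ℂ :=
  1 + (C (dd a d) * xv a * yv d) * ∏ e ∈ Finset.Iio d, (1 + C (dd a e) * yv e)

/-- Root-factor splitting of the `x`-side: `∏_{b<a} fx · (vertex part)` collapses to `ex`, modulo squares. -/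
theorem ex_split (g : Fin h → Fin h → ℂ) (a d : Fin h) :
    SqEq (ex g a d) ((1 + C (g a d) * xv a * yv d) * ∏ b ∈ Finset.Iio a, fx g b a d) := by
  have ht : ∀ H, SqEq ((C (g a d) * xv a * yv d) * (C (g a d) * xv a * yv d) * H) 0 := by
    intro H
    have : (C (g a d) * xv a * yv d) * (C (g a d) * xv a * yv d) * H =
        X (Fin.castAdd h a) * X (Fin.castAdd h a) * (C (g a d) * C (g a d) * yv d * yv d * H) := by simp only [xv, yv]; ring
    rw [this]; exact SqEq.sq_mul_zero _ _
  have hsplit := root_factor_split (Finset.Iio a) (C (g a d) * xv a * yv d) (fun b => C (g b d) * xv b) ht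
  refine hsplit.trans ?_
  have hfac : ∀ b ∈ Finset.Iio a, (1 + C (g a d) * xv a * yv d * (C (g b d) * xv b * ∏ b' ∈ (Finset.Iio a) with b' < b, (1 + C (g b' d) * xv b'))) =
      fx g b a d := by
    intro b hb
    have hI : (Finset.Iio a).filter (fun b' => b' < b) = Finset.Iio b := by
      ext b'; simp only [Finset.mem_filter, Finset.mem_Iio]
      constructor
      · exact fun hh => hh.2
      · intro hb'; exact ⟨lt_trans hb' (Finset.mem_Iio.mp hb), hb'⟩
    rw [hI]; rfl
  rw [Finset.prod_congr rfl hfac]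
  exact SqEq.refl _

/-- Root-factor splitting of the `y`-side: `∏_{e<d} fy · (vertex part)` collapses to `ey`, modulo squares. -/
theorem ey_split (dd : Fin h → Fin h → ℂ) (a d : Fin h) :
    SqEq (ey dd a d) ((1 + C (dd a d) * xv a * yv d) * ∏ e ∈ Finset.Iio d, fy dd a e d) := by
  have ht : ∀ H, SqEq ((C (dd a d) * xv a * yv d) * (C (dd a d) * xv a * yv d) * H) 0 := by
    intro H
    have : (C (dd a d) * xv a * yv d) * (C (dd a d) * xv a * yv d) * H =
        X (Fin.castAdd h a) * X (Fin.castAdd h a) * (C (dd a d) * C (dd a d) * yv d * yv d * H) := by simp only [xv, yv]; ring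
    rw [this]; exact SqEq.sq_mul_zero _ _
  have hsplit := root_factor_split (Finset.Iio d) (C (dd a d) * xv a * yv d) (fun e => C (dd a e) * yv e) ht
  refine hsplit.trans ?_
  have hfac : ∀ e ∈ Finset.Iio d, (1 + C (dd a d) * xv a * yv d * (C (dd a e) * yv e * ∏ e' ∈ (Finset.Iio d) with e' < e, (1 + C (dd a e') * yv e'))) =
      fy dd a e d := by
    intro e he
    have hI : (Finset.Iio d).filter (fun e' => e' < e) = Finset.Iio e := by
      ext e'; simp only [Finset.mem_filter, Finset.mem_Iio]
      constructor
      · exact fun hh => hh.2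
      · intro he'; exact ⟨lt_trans he' (Finset.mem_Iio.mp he), he'⟩
    rw [hI]; rfl
  rw [Finset.prod_congr rfl hfac]
  exact SqEq.refl _

/-- **Telescoping of the root factors of one column vertex:** `(1 + y_d) ∏_a ex(a,d) ≡ 1 + y_d ∏_a (1 + g_{ad} x_a)`. -/
theorem zeta_prod_ex (g : Fin h → Fin h → ℂ) (d : Fin h) :
    SqEq ((1 + yv d) * ∏ a : Fin h, ex g a d) (1 + yv d * ∏ a : Fin h, (1 + C (g a d) * xv a)) := by
  have hty : ∀ H, SqEq (yv d * yv d * H) 0 := fun H => SqEq.sq_mul_zero _ H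
  -- ∏_a ex = ∏_a (1 + y_d * s_a) ≡ 1 + y_d Σ_a s_a
  have hform : ∀ a : Fin h, ex g a d = 1 + yv d * (C (g a d) * xv a * ∏ b ∈ Finset.Iio a, (1 + C (g b d) * xv b)) := by
    intro a; rw [ex]; ring
  have hlin := prod_one_add_nil (Finset.univ : Finset (Fin h)) (yv d)
    (fun a => C (g a d) * xv a * ∏ b ∈ Finset.Iio a, (1 + C (g b d) * xv b)) hty
  have hprod : (∏ a : Fin h, ex g a d) = ∏ a : Fin h, (1 + yv d * (C (g a d) * xv a * ∏ b ∈ Finset.Iio a, (1 + C (g b d) * xv b))) :=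
    Finset.prod_congr rfl fun a _ => hform a
  have htel : ∏ a : Fin h, (1 + C (g a d) * xv a) = 1 + ∑ a : Fin h, C (g a d) * xv a * ∏ b ∈ Finset.Iio a, (1 + C (g b d) * xv b) := by
    rw [Finset.prod_one_add_ordered]
    congr 1
    refine Finset.sum_congr rfl fun a _ => ?_
    rw [filter_lt_eq_Iio]
  rw [hprod]
  refine (hlin.mul_left (1 + yv d)).trans ?_
  have hexp : (1 + yv d) * (1 + yv d * ∑ a : Fin h, C (g a d) * xv a * ∏ b ∈ Finset.Iio a, (1 + C (g b d) * xv b)) =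
      (1 + yv d * ∏ a : Fin h, (1 + C (g a d) * xv a)) +
        yv d * yv d * ∑ a : Fin h, C (g a d) * xv a * ∏ b ∈ Finset.Iio a, (1 + C (g b d) * xv b) := by
    rw [htel]; ring
  rw [hexp]
  have := (SqEq.refl (1 + yv d * ∏ a : Fin h, (1 + C (g a d) * xv a))).add (hty (∑ a : Fin h, C (g a d) * xv a * ∏ b ∈ Finset.Iio a, (1 + C (g b d) * xv b)))
  rw [add_zero] at this
  exact this

/-- The mirror: `(1 + x_a) ∏_d ey(a,d) ≡ 1 + x_a ∏_e (1 + dd_{ae} y_e)`. -/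
theorem zeta_prod_ey (dd : Fin h → Fin h → ℂ) (a : Fin h) :
    SqEq ((1 + xv a) * ∏ d : Fin h, ey dd a d) (1 + xv a * ∏ e : Fin h, (1 + C (dd a e) * yv e)) := by
  have htx : ∀ H, SqEq (xv a * xv a * H) 0 := fun H => SqEq.sq_mul_zero _ H
  have hform : ∀ d : Fin h, ey dd a d = 1 + xv a * (C (dd a d) * yv d * ∏ e ∈ Finset.Iio d, (1 + C (dd a e) * yv e)) := by
    intro d; rw [ey]; ring
  have hlin := prod_one_add_nil (Finset.univ : Finset (Fin h)) (xv a)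
    (fun d => C (dd a d) * yv d * ∏ e ∈ Finset.Iio d, (1 + C (dd a e) * yv e)) htx
  have hprod : (∏ d : Fin h, ey dd a d) = ∏ d : Fin h, (1 + xv a * (C (dd a d) * yv d * ∏ e ∈ Finset.Iio d, (1 + C (dd a e) * yv e))) :=
    Finset.prod_congr rfl fun d _ => hform d
  have htel : ∏ e : Fin h, (1 + C (dd a e) * yv e) = 1 + ∑ d : Fin h, C (dd a d) * yv d * ∏ e ∈ Finset.Iio d, (1 + C (dd a e) * yv e) := by
    rw [Finset.prod_one_add_ordered]
    congr 1
    refine Finset.sum_congr rfl fun d _ => ?_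
    rw [filter_lt_eq_Iio]
  rw [hprod]
  refine (hlin.mul_left (1 + xv a)).trans ?_
  have hexp : (1 + xv a) * (1 + xv a * ∑ d : Fin h, C (dd a d) * yv d * ∏ e ∈ Finset.Iio d, (1 + C (dd a e) * yv e)) =
      (1 + xv a * ∏ e : Fin h, (1 + C (dd a e) * yv e)) +
        xv a * xv a * ∑ d : Fin h, C (dd a d) * yv d * ∏ e ∈ Finset.Iio d, (1 + C (dd a e) * yv e) := by
    rw [htel]; ring
  rw [hexp]
  have := (SqEq.refl (1 + xv a * ∏ e : Fin h, (1 + C (dd a e) * yv e))).add (htx (∑ d : Fin h, C (dd a d) * yv d * ∏ e ∈ Finset.Iio d, (1 + C (dd a e) * yv e)))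
  rw [add_zero] at this
  exact this

/-- **THE PRODUCT DOOR IS IN 𝔄₂:** `(∏_a (1 + x_a)) (∏_d (1 + y_d)) · W₂(g, dd) ≡ Π(g, dd)` modulo squares. -/
theorem zeta_W2_sqeq_piPoly (g dd : Fin h → Fin h → ℂ) :
    SqEq ((∏ a : Fin h, (1 + xv a)) * (∏ d : Fin h, (1 + yv d)) * W2 g dd) (piPoly g dd) := by
  classical
  -- Step 1: W₂ ≡ (∏_d ∏_a ex) * (∏_a ∏_d ey)
  have h11 : SqEq (∏ α ∈ T11 h, starFactor g dd α)
      ((∏ d : Fin h, ∏ a : Fin h, (1 + C (g a d) * xv a * yv d)) * (∏ a : Fin h, ∏ d : Fin h, (1 + C (dd a d) * xv a * yv d))) := by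
    rw [prod_T11]
    have := SqEq.prod (Finset.univ : Finset (Fin h)) (fun a _ =>
      SqEq.prod (Finset.univ : Finset (Fin h)) (fun d _ => vtx_split g dd a d))
    refine this.trans ?_
    simp_rw [Finset.prod_mul_distrib]
    rw [Finset.prod_comm (f := fun a d => 1 + C (g a d) * xv a * yv d)]
    exact SqEq.refl _
  have hX : SqEq ((∏ d : Fin h, ∏ a : Fin h, (1 + C (g a d) * xv a * yv d)) * ∏ α ∈ T21 h, starFactor g dd α)
      (∏ d : Fin h, ∏ a : Fin h, ex g a d) := by
    rw [prod_T21, ← Finset.prod_mul_distrib]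
    refine SqEq.symm (SqEq.prod _ fun d _ => ?_)
    rw [← Finset.prod_mul_distrib]
    exact SqEq.prod _ fun a _ => ex_split g a d
  have hY : SqEq ((∏ a : Fin h, ∏ d : Fin h, (1 + C (dd a d) * xv a * yv d)) * ∏ α ∈ T12 h, starFactor g dd α)
      (∏ a : Fin h, ∏ d : Fin h, ey dd a d) := by
    rw [prod_T12, ← Finset.prod_mul_distrib]
    refine SqEq.symm (SqEq.prod _ fun a _ => ?_)
    rw [← Finset.prod_mul_distrib]
    exact SqEq.prod _ fun d _ => ey_split dd a d
  have hW : SqEq (W2 g dd) ((∏ d : Fin h, ∏ a : Fin h, ex g a d) * (∏ a : Fin h, ∏ d : Fin h, ey dd a d)) := by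
    rw [W2_eq_three]
    have h1 := ((h11.mul (SqEq.refl (∏ α ∈ T21 h, starFactor g dd α))).mul (SqEq.refl (∏ α ∈ T12 h, starFactor g dd α)))
    refine h1.trans ?_
    have hre : (∏ d : Fin h, ∏ a : Fin h, (1 + C (g a d) * xv a * yv d)) * (∏ a : Fin h, ∏ d : Fin h, (1 + C (dd a d) * xv a * yv d)) *
        (∏ α ∈ T21 h, starFactor g dd α) * (∏ α ∈ T12 h, starFactor g dd α) =
        ((∏ d : Fin h, ∏ a : Fin h, (1 + C (g a d) * xv a * yv d)) * ∏ α ∈ T21 h, starFactor g dd α) *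
        ((∏ a : Fin h, ∏ d : Fin h, (1 + C (dd a d) * xv a * yv d)) * ∏ α ∈ T12 h, starFactor g dd α) := by ring
    rw [hre]
    exact hX.mul hY
  -- Step 2: multiply by the zetas and telescope
  have hZX : SqEq ((∏ d : Fin h, (1 + yv d)) * ∏ d : Fin h, ∏ a : Fin h, ex g a d)
      (∏ d : Fin h, (1 + yv d * ∏ a : Fin h, (1 + C (g a d) * xv a))) := by
    rw [← Finset.prod_mul_distrib]
    exact SqEq.prod _ fun d _ => zeta_prod_ex g d
  have hZY : SqEq ((∏ a : Fin h, (1 + xv a)) * ∏ a : Fin h, ∏ d : Fin h, ey dd a d)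
      (∏ a : Fin h, (1 + xv a * ∏ e : Fin h, (1 + C (dd a e) * yv e))) := by
    rw [← Finset.prod_mul_distrib]
    exact SqEq.prod _ fun a _ => zeta_prod_ey dd a
  have h2 := (hW.mul_left ((∏ a : Fin h, (1 + xv a)) * (∏ d : Fin h, (1 + yv d))))
  refine h2.trans ?_
  have hre : (∏ a : Fin h, (1 + xv a)) * (∏ d : Fin h, (1 + yv d)) * ((∏ d : Fin h, ∏ a : Fin h, ex g a d) * (∏ a : Fin h, ∏ d : Fin h, ey dd a d)) =
      ((∏ d : Fin h, (1 + yv d)) * ∏ d : Fin h, ∏ a : Fin h, ex g a d) * ((∏ a : Fin h, (1 + xv a)) * ∏ a : Fin h, ∏ d : Fin h, ey dd a d) := by ring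
  rw [hre, piPoly]
  have h3 := hZX.mul hZY
  refine h3.trans ?_
  -- match the shape of `piPoly` (its x-half uses the bound name `b`)
  exact SqEq.refl _

/-! ## 5. The star-forest block is `Zᵀ · (layout of W₂) · Z` on lower pairs -/

/-- The two zeta products are the sum of all square-free monomials. -/
theorem zeta_zeta_eq_sum :
    (∏ a : Fin h, (1 + xv a)) * (∏ d : Fin h, (1 + yv d)) =
      ∑ A : Finset (Fin h), ∑ S : Finset (Fin h), monomial (pexpo A S) (1 : ℂ) := by
  classical
  rw [Finset.prod_one_add, Finset.prod_one_add, Finset.powerset_univ, Finset.sum_mul]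
  refine Finset.sum_congr rfl fun A _ => ?_
  rw [Finset.mul_sum]
  refine Finset.sum_congr rfl fun S _ => ?_
  exact prod_xv_mul_prod_yv A S

/-- **Zeta twist of coefficients:** `coeff_{x^U y^W} (ζ_x ζ_y F) = Σ_{A ⊆ U, S ⊆ W} coeff_{x^A y^S} F`. -/
theorem coeff_pexpo_zeta_mul (F : MvPolynomial (Fin (h + h)) ℂ) (U W : Finset (Fin h)) :
    coeff (pexpo U W) ((∏ a : Fin h, (1 + xv a)) * (∏ d : Fin h, (1 + yv d)) * F) =
      ∑ A ∈ U.powerset, ∑ S ∈ W.powerset, coeff (pexpo A S) F := by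
  classical
  rw [mul_comm, zeta_zeta_eq_sum, coeff_pexpo_mul_sum_monomial]
  simp_rw [mul_one]
  -- reindex A ↦ U \ A and S ↦ W \ S
  refine Finset.sum_nbij' (fun A => U \ A) (fun A => U \ A) ?_ ?_ ?_ ?_ ?_
  · intro A _; exact Finset.mem_powerset.mpr Finset.sdiff_subset
  · intro A _; exact Finset.mem_powerset.mpr Finset.sdiff_subset
  · intro A hA; exact Finset.sdiff_sdiff_eq_self (Finset.mem_powerset.mp hA)
  · intro A hA; exact Finset.sdiff_sdiff_eq_self (Finset.mem_powerset.mp hA)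
  · intro A hA
    refine Finset.sum_nbij' (fun S => W \ S) (fun S => W \ S) ?_ ?_ ?_ ?_ ?_
    · intro S _; exact Finset.mem_powerset.mpr Finset.sdiff_subset
    · intro S _; exact Finset.mem_powerset.mpr Finset.sdiff_subset
    · intro S hS; exact Finset.sdiff_sdiff_eq_self (Finset.mem_powerset.mp hS)
    · intro S hS; exact Finset.sdiff_sdiff_eq_self (Finset.mem_powerset.mp hS)
    · intro S hS; rfl

/-- For an injective LOWER family, a sum over the subsets of `u i` is a sum over the indices `i'` with `u i' ⊆ u i`. -/
theorem sum_powerset_eq_sum_index {r : ℕ} (u : Fin r → Finset (Fin h)) (hu : Function.Injective u) (hlu : IsLowerSet (Set.range u))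
    (f : Finset (Fin h) → ℂ) (i : Fin r) :
    ∑ A ∈ (u i).powerset, f A = ∑ i' ∈ Finset.univ.filter (fun i' : Fin r => u i' ⊆ u i), f (u i') := by
  classical
  have himg : (Finset.univ.filter (fun i' : Fin r => u i' ⊆ u i)).image u = (u i).powerset := by
    ext S
    simp only [Finset.mem_image, Finset.mem_filter, Finset.mem_univ, true_and, Finset.mem_powerset]
    constructor
    · rintro ⟨i', hi', rfl⟩; exact hi'
    · intro hS
      obtain ⟨i', hi'⟩ : S ∈ Set.range u := hlu (show S ≤ u i from hS) ⟨i, rfl⟩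
      exact ⟨i', by rw [hi']; exact hS, hi'⟩
  rw [← himg, Finset.sum_image (fun j₁ _ j₂ _ hj => hu hj)]

/-- Bookkeeping: a double sum over two filters is the `(i, j)` entry of `Zᵀ · C · Z'` with `0/1` matrices `Z`, `Z'`. -/
theorem sum_filter_filter_eq {r : ℕ} (p q : Fin r → Prop) [DecidablePred p] [DecidablePred q] (c : Fin r → Fin r → ℂ) :
    ∑ i' ∈ Finset.univ.filter p, ∑ j' ∈ Finset.univ.filter q, c i' j' =
      ∑ j', (∑ i', (if p i' then (1 : ℂ) else 0) * c i' j') * (if q j' then 1 else 0) := by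
  rw [Finset.sum_comm, Finset.sum_filter]
  refine Finset.sum_congr rfl fun j' _ => ?_
  split_ifs
  · rw [mul_one, Finset.sum_filter]
    refine Finset.sum_congr rfl fun i' _ => ?_
    split_ifs <;> simp
  · simp

/-- **The star-forest block factors through the layout of `W₂`:** `star = Zuᵀ · M · Zw` for injective lower `u`, `w`. -/
theorem starMatrix_eq {r : ℕ} (g dd : Fin h → Fin h → ℂ) (u w : Fin r → Finset (Fin h)) (hu : Function.Injective u)
    (hw : Function.Injective w) (hlu : IsLowerSet (Set.range u)) (hlw : IsLowerSet (Set.range w)) :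
    (Matrix.of fun i j : Fin r => starEntry g dd (u i) (w j)) =
      (Matrix.of fun i' i : Fin r => if u i' ⊆ u i then (1 : ℂ) else 0).transpose *
        (Matrix.of fun i' j' : Fin r => coeff (pexpo (u i') (w j')) (W2 g dd)) *
        (Matrix.of fun j' j : Fin r => if w j' ⊆ w j then (1 : ℂ) else 0) := by
  classical
  ext i j
  have hsq := zeta_W2_sqeq_piPoly g dd (pexpo (u i) (w j)) (pexpo_apply_le_one (u i) (w j))
  rw [Matrix.of_apply, ← coeff_pexpo_piPoly, ← hsq, coeff_pexpo_zeta_mul,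
    sum_powerset_eq_sum_index u hu hlu _ i]
  simp_rw [sum_powerset_eq_sum_index w hw hlw _ j]
  simp only [Matrix.mul_apply, Matrix.transpose_apply, Matrix.of_apply]
  exact sum_filter_filter_eq _ _ _

/-- The layout of `W₂` has determinant `eval (symbolicDet 2)` at the star point. -/
theorem det_layout_W2 {r : ℕ} (g dd : Fin h → Fin h → ℂ) (u w : Fin r → Finset (Fin h)) :
    (Matrix.of fun i' j' : Fin r => coeff (pexpo (u i') (w j')) (W2 g dd)).det =
      MvPolynomial.eval (starPoint g dd) (symbolicDet 2 h r u w) := by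
  rw [symbolicDet, RingHom.map_det]
  congr 1

/-- **A nonsingular star-forest block on an injective lower pair forces `symbolicDet 2 ≠ 0`.** -/
theorem symbolicDet_two_ne_zero_of_starDet {r : ℕ} (g dd : Fin h → Fin h → ℂ) (u w : Fin r → Finset (Fin h))
    (hu : Function.Injective u) (hw : Function.Injective w) (hlu : IsLowerSet (Set.range u)) (hlw : IsLowerSet (Set.range w))
    (hdet : (Matrix.of fun i j : Fin r => starEntry g dd (u i) (w j)).det ≠ 0) : symbolicDet 2 h r u w ≠ 0 := by
  intro h0
  apply hdet
  rw [starMatrix_eq g dd u w hu hw hlu hlw, Matrix.det_mul, Matrix.det_mul, det_layout_W2, h0, map_zero, mul_zero, zero_mul]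

end StarDoor

/-! ## 6. The arrows to the item -/

/-- **STAR-LOWER ⟹ `symbolicDet 2 ≠ 0` on every injective lower pair.** -/
theorem symbolicDet_two_ne_zero_of_conjStarLower (H : Stmt.conjStarLower) (h r : ℕ) (u w : Fin r → Finset (Fin h))
    (hu : Function.Injective u) (hw : Function.Injective w) (hlu : IsLowerSet (Set.range u)) (hlw : IsLowerSet (Set.range w)) :
    symbolicDet 2 h r u w ≠ 0 := by
  obtain ⟨g, dd, hdet⟩ := H h r u w hu hw hlu hlw
  exact StarDoor.symbolicDet_two_ne_zero_of_starDet g dd u w hu hw hlu hlw hdet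

/-- STAR-LOWER ⟹ the line's symbolic non-vanishing stub (`s := 2`, `h₀ := 0`). -/
theorem stub_symbolicNonvanishing_of_conjStarLower (H : Stmt.conjStarLower) : Stmt.stub_symbolicNonvanishing :=
  ⟨2, 0, fun h _ r u w hu hw hlu hlw => symbolicDet_two_ne_zero_of_conjStarLower H h r u w hu hw hlu hlw⟩

/-- STAR-LOWER ⟹ an anchored hit of profile 2 on every injective lower pair. -/
theorem anchoredHit_of_conjStarLower (H : Stmt.conjStarLower) (h r : ℕ) (u w : Fin r → Finset (Fin h))
    (hu : Function.Injective u) (hw : Function.Injective w) (hlu : IsLowerSet (Set.range u)) (hlw : IsLowerSet (Set.range w)) :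
    AnchoredHit 2 h r u w :=
  stub_genericPoint 2 h r u w (symbolicDet_two_ne_zero_of_conjStarLower H h r u w hu hw hlu hlw)

/-- **COMPOSITION BY NAME: `Stmt.conjStarLower → AnchoredDoorHitsLowerPairs`** (the support item, with `s = 2`, `h₀ = 0`). -/
theorem anchoredDoorHitsLowerPairs_of_conjStarLower (H : Stmt.conjStarLower) :
    Summit.ValiantsHypothesis.ValiantsHypothesis.Theses.BarrierLever.AnchoredDoorHitsLowerPairs :=
  ⟨2, 0, fun h _ r u w hu hw hlu hlw => anchoredHit_of_conjStarLower H h r u w hu hw hlu hlw⟩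

/-- **COMPOSITION BY NAME: `Stmt.conjStarTN → AnchoredDoorHitsLowerPairs`** (total nonsingularity of the star-forest matrix suffices). -/
theorem anchoredDoorHitsLowerPairs_of_conjStarTN (H : Stmt.conjStarTN) :
    Summit.ValiantsHypothesis.ValiantsHypothesis.Theses.BarrierLever.AnchoredDoorHitsLowerPairs :=
  anchoredDoorHitsLowerPairs_of_conjStarLower (conjStarLower_of_conjStarTN H)

end

end Summit.ValiantsHypothesis.ValiantsHypothesis.Theorems.BarrierLever.AnchoredPeeling
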